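import Literature.NumberTheory.LFunctions.TwistedDedekindCoefficients
import HarnessLib

/-!
# `Re L(Λ_K, s) ≤ Re 1/(s − 1) + C_K log(|t| + 4)` for `σ > 1`

The companion bound of de la Vallée Poussin type for the Dedekind von Mangoldt series
`L(Λ_K, s) = −ζ_K'/ζ_K(s)` (`Λ_K = vonMangoldtNorm K` of `TwistedDedekindCoefficients`), read off the
tree's zero-free-region datum of `ζ_K` (`ClassicalZFRData (vonMangoldtIdeal K) G η`, `G` = Landau's
continuation of `(s − 1)ζ_K(s)`, `PrimeIdealTheoremProofs`): `L(Λ_K, s) = 1/(s−1) − G'/G(s)` and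
`‖G'/G(s)‖ ≤ C log(|t|+4)` in the classical region, in particular for `σ > 1`
(`ClassicalZFRData.norm_logDeriv_le`). This is the field `re_LSeries₂_le` (case `pole = true`,
`Λ₂ = Λ_K`) of `TwistedZFRData` for a real twisted character (T. Mitsui 1956, Lemma 5; Heath-Brown
2001, Lemma 9.4). Everything is PROVED; no definitions.

## References

* H. L. Montgomery, R. C. Vaughan, *Multiplicative Number Theory I*, CUP 2007, Theorem 6.7, §11.1 Case 2.
  [cite: MontgomeryVaughan2007, Theorem 6.7]
* E. Landau, *Neuer Beweis des Primzahlsatzes und Beweis des Primidealsatzes*, Math. Ann. 56 (1903).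
  [cite: LandauMathAnn1903, §13]

## Mathlib / tree search

Tree: `exists_isLandauContinuation_holds`, `classicalZFRData_of_isLandauContinuation`,
`ClassicalZFRData.norm_logDeriv_le`, `ClassicalZFRData.logDeriv_eq`, `LSeries_vonMangoldtNorm_eq`.
-/

noncomputable section

open Complex
open scoped NumberField

namespace Literature.NumberTheory.LFunctions.NumberField

variable (K : Type*) [Field K] [NumberField K]

/-- **`Re L(Λ_K, s) ≤ Re 1/(s − 1) + C_K log(|t| + 4)` for `σ > 1`** (and the norm version
`‖L(Λ_K, s) − 1/(s−1)‖ ≤ C_K log(|t|+4)`), `C_K ≥ 0` depending on `K` only.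
[cite: MontgomeryVaughan2007, Theorem 6.7] -/
theorem exists_re_LSeries_vonMangoldtNorm_le_pole :
    ∃ C : ℝ, 0 ≤ C ∧ ∀ s : ℂ, 1 < s.re →
      ‖LSeries (fun n ↦ (vonMangoldtNorm K n : ℂ)) s - 1 / (s - 1)‖ ≤ C * Real.log (|s.im| + 4) ∧
      (LSeries (fun n ↦ (vonMangoldtNorm K n : ℂ)) s).re ≤ (1 / (s - 1)).re + C * Real.log (|s.im| + 4) := by
  obtain ⟨G, hG, hG1, hgrowth⟩ := exists_isLandauContinuation_holds K
  have hZ := classicalZFRData_of_isLandauContinuation hG hG1 hgrowth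
  obtain ⟨c, hc, C, hC, hreg⟩ := hZ.norm_logDeriv_le
  refine ⟨C, hC, fun s hs ↦ ?_⟩
  have hη : 1 - 1 / (2 * (Module.finrank ℚ K : ℝ)) < s.re := by
    have : 0 < 1 / (2 * (Module.finrank ℚ K : ℝ)) := by
      have := one_le_finrank K; positivity
    linarith
  have hregion : 1 - c / Real.log (|s.im| + 4) ≤ s.re := by
    have : 0 < c / Real.log (|s.im| + 4) := div_pos hc (ClassicalZFRData.log_tau_pos _)
    linarith
  obtain ⟨-, hbound⟩ := hreg s hη hregion
  have hL : LSeries (fun n ↦ (vonMangoldtNorm K n : ℂ)) s = 1 / (s - 1) - deriv G s / G s := by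
    rw [LSeries_vonMangoldtNorm_eq (K := K) hs, hZ.logDeriv_eq s hs]; ring
  have h1 : ‖LSeries (fun n ↦ (vonMangoldtNorm K n : ℂ)) s - 1 / (s - 1)‖ ≤ C * Real.log (|s.im| + 4) := by
    rw [hL, sub_sub_cancel_left, norm_neg]; exact hbound
  refine ⟨h1, ?_⟩
  have h2 : (LSeries (fun n ↦ (vonMangoldtNorm K n : ℂ)) s).re =
      (1 / (s - 1)).re + (LSeries (fun n ↦ (vonMangoldtNorm K n : ℂ)) s - 1 / (s - 1)).re := by
    rw [Complex.sub_re]; ring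
  rw [h2]
  have := (Complex.abs_re_le_norm _).trans h1
  linarith [le_abs_self (LSeries (fun n ↦ (vonMangoldtNorm K n : ℂ)) s - 1 / (s - 1)).re]

end Literature.NumberTheory.LFunctions.NumberField
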